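import Summits.Ventures.WeilGRH.TwistedWindowMeasureGrowth
import Summits.Ventures.WeilGRH.FlatWindowArchCostSeries
import Summits.Ventures.WeilGRH.ZetaFlatWindowSpectral
import HarnessLib

/-!
# GRH arm (rh-explicit, venture WeilGRH): THE FLAT-WINDOW LAW WITH ALL CONSTANTS IDENTIFIED —
  `2S_χ(a) + 2a·μ{0} = log q − K_κ + T_κ/a − Z′(a) − E(a)`, `0 ≤ Z′ ≤ (2/a)∫t⁻²dμ`, `0 ≤ E ≤ e^{−(1+2κ)a}T_κ/a`

Cell `rh-explicit`, WEIL TRACK (structure seat weil-3, gen9).  Assembly of `FlatWindowSpectral` (the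
identity / sandwich), `TwistedWindowMeasureGrowth` (the growth hypothesis discharged) and
`FlatWindowArchCostSeries` (`T_κ(1 − e^{−(1+2κ)a}) ≤ I_κ(a) ≤ T_κ`, `T_κ = Σ_m(2m+½+κ)⁻²`):

* **`flatSum_sub_affine_mem`** (measure level, RH/GRH-free): for `χ` mod `q ≠ 1`, `a > 0`, EVERY positive
  `μ` representing `Q_χ` on the tests of `[-a, a]` with `t⁻² ∈ L¹(μ)`,
  `−((2/a)∫t⁻²dμ·a… ) …` precisely
  `−(2∫t⁻²dμ + e^{−(1+2κ)a}T_κ)/a ≤ 2S_χ(a) + 2a·μ{0} − (log q − K_κ) − T_κ/a ≤ 0`;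
* **`flatSum_sub_affine_mem_of_grh`**: under `GRH(χ)` (`χ` primitive mod `q ≠ 1`) the same with
  `μ = ν_χ`, `μ{0} = ord_{s=½}L(s,χ)`;
* **`zetaFlatSum_sub_affine_mem_of_riemannHypothesis`**: under RH,
  `−(2Σ_ρ m/γ² + e^{−a}T₀)/a ≤ 2Σ_{log n<2a}Λ(n)n^{-1/2}(1 − log n/(2a)) − 16 sinh²(a/2)/a + 2ζ′(½)/ζ(½) − T₀/a ≤ 0`.

So the smoothed prime sum below the horizon is, to `O(1/a)` with a SIGNED error, the affine-plus-hyperbola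
`−2a·(atom) + (log q − K_κ) + T_κ/a`: slope = spectral mass at the centre, intercept = `−2Re(L′/L)(½,χ)`
(`log q − K_κ`), `1/a`-coefficient = `ψ′((2κ+1)/4)/4`; zeros off the centre and the archimedean defect
only LOWER it, by at most `(2∫t⁻²dμ + e^{−(1+2κ)a}T_κ)/a`.  No definitions, no named facts.
-/

set_option autoImplicit false

noncomputable section

open Complex Filter Set MeasureTheory
open scoped Real Topology ComplexConjugate ArithmeticFunction.vonMangoldt

namespace Summit.Ventures.WeilGRH

open Literature.NumberTheory.LFunctions
open Literature.NumberTheory.LFunctions.ExplicitPsiChar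
open Literature.NumberTheory.LFunctions.WeilBochner (charZeroHeightMeasure zetaZeroHeightMeasure)

variable {q : ℕ} {a : ℝ}

/-- **THE FLAT-WINDOW LAW WITH ALL CONSTANTS IDENTIFIED (measure level, RH/GRH-free).**  For `χ` mod
`q ≠ 1`, `a > 0`, every positive `μ` representing `Q_χ` on the tests of `[-a, a]` with `t⁻² ∈ L¹(μ)`:

  `−(2∫t⁻²dμ + e^{−(1+2κ)a}T_κ)/a ≤ 2S_χ(a) + 2a·μ{0} − (log q − K_κ) − T_κ/a ≤ 0`

(`T_κ = Σ_m (2m+½+κ)⁻²`). -/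
theorem flatSum_sub_affine_mem (hq : q ≠ 1) (χ : DirichletCharacter ℂ q) (ha : 0 < a) {μ : Measure ℝ}
    (hμ : ∀ g : ℝ → ℂ, IsWeilTest g → tsupport g ⊆ Icc (-a) a →
      Integrable (fun t : ℝ ↦ ‖weilMellin g (1 / 2 + t * I)‖ ^ 2) μ ∧
        weilQuadraticChar χ g = ((∫ t, ‖weilMellin g (1 / 2 + t * I)‖ ^ 2 ∂μ : ℝ) : ℂ))
    (hM : Integrable (fun t : ℝ ↦ (t ^ 2)⁻¹) μ) :
    -(2 * (∫ t, (t ^ 2)⁻¹ ∂μ) + Real.exp (-((1 + 2 * (charParity χ : ℝ)) * a)) *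
          ∑' m : ℕ, 1 / (2 * (m : ℝ) + 1 / 2 + (charParity χ : ℝ)) ^ 2) / a ≤
        2 * (∑ n ∈ weilPrimeIndex a,
            (Λ n : ℝ) / Real.sqrt n * ((1 - Real.log n / (2 * a)) * (χ (n : ZMod q)).re)) +
          2 * a * μ.real {0} -
          (Real.log q - (Real.log (4 * π) + Real.eulerMascheroniConstant +
            2 * ∫ t in Ioi (0 : ℝ), weilKillingDensityPar (charParity χ) t)) -
          (∑' m : ℕ, 1 / (2 * (m : ℝ) + 1 / 2 + (charParity χ : ℝ)) ^ 2) / a ∧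
      2 * (∑ n ∈ weilPrimeIndex a,
            (Λ n : ℝ) / Real.sqrt n * ((1 - Real.log n / (2 * a)) * (χ (n : ZMod q)).re)) +
          2 * a * μ.real {0} -
          (Real.log q - (Real.log (4 * π) + Real.eulerMascheroniConstant +
            2 * ∫ t in Ioi (0 : ℝ), weilKillingDensityPar (charParity χ) t)) -
          (∑' m : ℕ, 1 / (2 * (m : ℝ) + 1 / 2 + (charParity χ : ℝ)) ^ 2) / a ≤ 0 := by
  obtain ⟨hlo, hhi⟩ := flatWindow_sandwich' hq χ ha hμ hM
  obtain ⟨hIlo, hIhi⟩ := integral_weilArchDensityPar_mul_min_mem (charParity χ) ha.le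
  set Iκ := ∫ t in Ioi (0 : ℝ), weilArchDensityPar (charParity χ) t * min t (2 * a) with hIκ
  set T := ∑' m : ℕ, 1 / (2 * (m : ℝ) + 1 / 2 + (charParity χ : ℝ)) ^ 2 with hT
  set M₂ := ∫ t, (t ^ 2)⁻¹ ∂μ with hM₂
  set ε := Real.exp (-((1 + 2 * (charParity χ : ℝ)) * a)) with hε
  have e1 : 1 / a * Iκ ≤ T / a := by
    rw [one_div_mul_eq_div]; exact div_le_div_of_nonneg_right hIhi ha.le
  have e2 : (1 - ε) * T / a ≤ 1 / a * Iκ := by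
    rw [one_div_mul_eq_div]; exact div_le_div_of_nonneg_right hIlo ha.le
  have e3 : -(2 * M₂ + ε * T) / a = -(2 / a * M₂) - ε * T / a := by field_simp; ring
  have e4 : (1 - ε) * T / a = T / a - ε * T / a := by field_simp
  rw [e3]
  rw [e4] at e2
  constructor <;> linarith

/-- **Under `GRH(χ)`** (`χ` primitive mod `q ≠ 1`): with `C_χ = Σ_ρ m(ρ)/γ²` (finite, unconditional) and
`m = ord_{s=½} L(s, χ)`, for every `a > 0`:
`−(2C_χ + e^{−(1+2κ)a}T_κ)/a ≤ 2S_χ(a) + 2a·m − (log q − K_κ) − T_κ/a ≤ 0`. -/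
theorem flatSum_sub_affine_mem_of_grh [NeZero q] {χ : DirichletCharacter ℂ q} (hq : q ≠ 1)
    (hprim : χ.IsPrimitive) (hGRH : χ.RiemannHypothesis) (ha : 0 < a) :
    -(2 * (∫ t, (t ^ 2)⁻¹ ∂charZeroHeightMeasure χ) + Real.exp (-((1 + 2 * (charParity χ : ℝ)) * a)) *
          ∑' m : ℕ, 1 / (2 * (m : ℝ) + 1 / 2 + (charParity χ : ℝ)) ^ 2) / a ≤
        2 * (∑ n ∈ weilPrimeIndex a,
            (Λ n : ℝ) / Real.sqrt n * ((1 - Real.log n / (2 * a)) * (χ (n : ZMod q)).re)) +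
          2 * a * (DirichletDisc.zeroOrder χ (1 / 2) : ℝ) -
          (Real.log q - (Real.log (4 * π) + Real.eulerMascheroniConstant +
            2 * ∫ t in Ioi (0 : ℝ), weilKillingDensityPar (charParity χ) t)) -
          (∑' m : ℕ, 1 / (2 * (m : ℝ) + 1 / 2 + (charParity χ : ℝ)) ^ 2) / a ∧
      2 * (∑ n ∈ weilPrimeIndex a,
            (Λ n : ℝ) / Real.sqrt n * ((1 - Real.log n / (2 * a)) * (χ (n : ZMod q)).re)) +
          2 * a * (DirichletDisc.zeroOrder χ (1 / 2) : ℝ) -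
          (Real.log q - (Real.log (4 * π) + Real.eulerMascheroniConstant +
            2 * ∫ t in Ioi (0 : ℝ), weilKillingDensityPar (charParity χ) t)) -
          (∑' m : ℕ, 1 / (2 * (m : ℝ) + 1 / 2 + (charParity χ : ℝ)) ^ 2) / a ≤ 0 := by
  have hq1 : 1 < q := lt_of_le_of_ne NeZero.one_le (Ne.symm hq)
  have hχ : χ ≠ 1 := by
    rintro rfl
    rw [DirichletCharacter.isPrimitive_def, DirichletCharacter.conductor_one] at hprim
    exact hq hprim.symm
  rw [← charZeroHeightMeasure_real_singleton_zero_of_grh hχ hGRH]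
  exact flatSum_sub_affine_mem hq χ ha
    (fun g hg _ ↦ WeilBochner.weilQuadraticChar_eq_integral_of_riemannHypothesis hq hprim hGRH hg)
    (integrable_inv_sq_charZeroHeightMeasure hprim hq1)

/-- **Under RH, for `ζ`**: with `C = Σ_ρ m(ρ)/γ²` over the zeros of `ζ` (`= 0.0924…`) and
`T₀ = Σ_m (2m+½)⁻² = ψ′(¼)/4`, for every `a > 0`:

  `−(2C + e^{−a}T₀)/a ≤ 2Σ_{log n<2a} Λ(n)n^{-1/2}(1 − log n/(2a)) − 16 sinh²(a/2)/a + 2ζ′(½)/ζ(½) − T₀/a ≤ 0`,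

i.e. `2Σ_{n<x}Λ(n)n^{-1/2}(1 − log n/log x) = 8(√x − 2 + x^{-1/2})/log x − 2ζ′(½)/ζ(½) + ψ′(¼)/(2 log x) − θ·(4C + 2e^{−a}T₀)/log x`,
`θ ∈ [0, 1]`. -/
theorem zetaFlatSum_sub_affine_mem_of_riemannHypothesis (hRH : RiemannHypothesis) (ha : 0 < a) :
    -(2 * (∫ t, (t ^ 2)⁻¹ ∂zetaZeroHeightMeasure) + Real.exp (-a) * ∑' m : ℕ, 1 / (2 * (m : ℝ) + 1 / 2 + (0 : ℕ)) ^ 2) / a ≤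
        2 * (∑ n ∈ weilPrimeIndex a, (Λ n : ℝ) / Real.sqrt n * (1 - Real.log n / (2 * a))) -
          (16 * Real.sinh (a / 2) ^ 2 / a - 2 * (deriv riemannZeta (1 / 2) / riemannZeta (1 / 2)).re) -
          (∑' m : ℕ, 1 / (2 * (m : ℝ) + 1 / 2 + (0 : ℕ)) ^ 2) / a ∧
      2 * (∑ n ∈ weilPrimeIndex a, (Λ n : ℝ) / Real.sqrt n * (1 - Real.log n / (2 * a))) -
          (16 * Real.sinh (a / 2) ^ 2 / a - 2 * (deriv riemannZeta (1 / 2) / riemannZeta (1 / 2)).re) -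
          (∑' m : ℕ, 1 / (2 * (m : ℝ) + 1 / 2 + (0 : ℕ)) ^ 2) / a ≤ 0 := by
  obtain ⟨hlo, hhi⟩ := zetaFlatSum_sandwich_of_riemannHypothesis hRH ha
  obtain ⟨hIlo, hIhi⟩ := integral_weilArchDensityPar_mul_min_mem 0 ha.le
  set Iκ := ∫ t in Ioi (0 : ℝ), weilArchDensityPar 0 t * min t (2 * a) with hIκ
  set T := ∑' m : ℕ, 1 / (2 * (m : ℝ) + 1 / 2 + ((0 : ℕ) : ℝ)) ^ 2 with hT
  set M₂ := ∫ t, (t ^ 2)⁻¹ ∂zetaZeroHeightMeasure with hM₂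
  have hε' : Real.exp (-((1 + 2 * ((0 : ℕ) : ℝ)) * a)) = Real.exp (-a) := by norm_num
  rw [hε'] at hIlo
  set ε := Real.exp (-a) with hε
  have e1 : 1 / a * Iκ ≤ T / a := by
    rw [one_div_mul_eq_div]; exact div_le_div_of_nonneg_right hIhi ha.le
  have e2 : (1 - ε) * T / a ≤ 1 / a * Iκ := by
    rw [one_div_mul_eq_div]; exact div_le_div_of_nonneg_right hIlo ha.le
  have e3 : -(2 * M₂ + ε * T) / a = -(2 / a * M₂) - ε * T / a := by field_simp; ring
  have e4 : (1 - ε) * T / a = T / a - ε * T / a := by field_simp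
  rw [e3]
  rw [e4] at e2
  constructor <;> linarith

end Summit.Ventures.WeilGRH

end
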